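import Summits.AtomisticToContinuum.HydrodynamicLimit.Theorems.InformationPercolationEngineChaosClosesEulerWeakLimitToolkit
import HarnessLib

/-!
# Energy distance on `ℝ³` — helper A: the abstract energy identity

Helper for the line `Sketch` of the crux `InformationPercolationEngine.ChaosClosesEuler`
(stmt-AtomisticToContinuum-15141), registered stub `stub_energyDistance` (conditional negative type of the
Euclidean distance and stability of its equality case).  This file is pure measure theory on abstract spaces:
for a bounded jointly measurable `f : X × Y → ℝ` which is square integrable under `ρ ⊗ η` and `τ ⊗ η`
(`ρ`, `τ` finite measures on `X`, `η` σ-finite on `Y`) the pair kernel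
`K(a,b) = ∫ (f(a,y) - f(b,y))² dη(y)` satisfies

* `∫∫ K dτ dρ = |τ| ∫∫ f² d(ρ⊗η) + |ρ| ∫∫ f² d(τ⊗η) - 2 ∫ F_ρ F_τ dη` with `F_ρ(y) = ∫ f(a,y) dρ(a)`
  (`integral_integral_kernel_eq`, Fubini on `(ρ ⊗ τ) ⊗ η`);
* hence for equal masses the ENERGY IDENTITY
  `2∫∫K dν dμ - ∫∫K dμ dμ - ∫∫K dν dν = 2 ∫ (F_μ - F_ν)² dη ≥ 0` (`energy_identity`), with equality iff
  `F_μ = F_ν` `η`-a.e. (`ae_eq_of_energy_eq_zero`).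

Applied in helper B to `X = ℝ³`, `Y = S² × ℝ`, `f(v,(ω,t)) = 1{⟪v,ω⟫ ≤ t} - 1{0 ≤ t}`, for which
`K(v,w) = 2π‖v - w‖` (slicing), this is Székely's representation of the energy distance.

References: G. J. Székely, M. L. Rizzo, *Energy statistics*, J. Statist. Plann. Inference 143 (2013), Prop. 1–2;
L. Mattner, *Strict definiteness of integrals via complete monotonicity of derivatives*, Trans. AMS 349 (1997).
-/

noncomputable section

namespace Summit.AtomisticToContinuum.HydrodynamicLimit.Theorems.ChaosClosesEulerEnergyDistance

open scoped BigOperators Topology Classical MeasureTheory ENNReal InnerProductSpace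
open Filter Set MeasureTheory
open Literature.MathematicalPhysics.KineticTheory

variable {X Y : Type*} [MeasurableSpace X] [MeasurableSpace Y]

/-- A measurable real function bounded by `B` in absolute value is integrable under a finite measure. [folklore] -/
theorem integrable_of_measurable_abs_le {Ω : Type*} [MeasurableSpace Ω] {ρ : Measure Ω} [IsFiniteMeasure ρ]
    {g : Ω → ℝ} (hg : Measurable g) {B : ℝ} (hB : ∀ x, |g x| ≤ B) : Integrable g ρ :=
  Integrable.of_bound hg.aestronglyMeasurable B (Eventually.of_forall fun x => by rw [Real.norm_eq_abs]; exact hB x)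

/-- Squares of a function bounded by one are bounded by one. [folklore] -/
theorem abs_sq_le_one_of_abs_le_one {x : ℝ} (h : |x| ≤ 1) : |x ^ 2| ≤ 1 := by
  rw [abs_pow]; nlinarith [abs_nonneg x]

/-- Products of functions bounded by one are bounded by one. [folklore] -/
theorem abs_mul_le_one_of_abs_le_one {x y : ℝ} (hx : |x| ≤ 1) (hy : |y| ≤ 1) : |x * y| ≤ 1 := by
  rw [abs_mul]; nlinarith [abs_nonneg x, abs_nonneg y]

/-- **The pair kernel through Fubini.** For a bounded jointly measurable `f : X × Y → ℝ`, square integrable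
under `ρ ⊗ η` and `τ ⊗ η`, the kernel `K(a,b) = ∫ (f(a,y) - f(b,y))² dη` has
`∫∫ K dτ dρ = |τ| ∫ f² d(ρ⊗η) + |ρ| ∫ f² d(τ⊗η) - 2 ∫ F_ρ F_τ dη`, `F_ρ(y) = ∫ f(a,y) dρ(a)`, and `F_ρ F_τ` is
`η`-integrable. [folklore] -/
theorem integral_integral_kernel_eq {f : X × Y → ℝ} (hf : Measurable f) (hb : ∀ p, |f p| ≤ 1)
    (ρ τ : Measure X) [IsFiniteMeasure ρ] [IsFiniteMeasure τ] (η : Measure Y) [SigmaFinite η]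
    (hρ : Integrable (fun p => f p ^ 2) (ρ.prod η)) (hτ : Integrable (fun p => f p ^ 2) (τ.prod η)) :
    Integrable (fun y => (∫ a, f (a, y) ∂ρ) * (∫ b, f (b, y) ∂τ)) η ∧
    ∫ a, ∫ b, (∫ y, (f (a, y) - f (b, y)) ^ 2 ∂η) ∂τ ∂ρ =
      τ.real univ * ∫ p, f p ^ 2 ∂(ρ.prod η) + ρ.real univ * ∫ p, f p ^ 2 ∂(τ.prod η)
        - 2 * ∫ y, (∫ a, f (a, y) ∂ρ) * (∫ b, f (b, y) ∂τ) ∂η := by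
  -- measurability of the three pieces on `(X × X) × Y`
  have hm1 : Measurable fun p : (X × X) × Y => f (p.1.1, p.2) :=
    hf.comp (measurable_fst.fst.prodMk measurable_snd)
  have hm2 : Measurable fun p : (X × X) × Y => f (p.1.2, p.2) :=
    hf.comp (measurable_fst.snd.prodMk measurable_snd)
  -- integrability of `f(a,y)²` and `f(b,y)²` on `(ρ ⊗ τ) ⊗ η`
  have hg1 : Integrable (fun p : (X × X) × Y => f (p.1.1, p.2) ^ 2) ((ρ.prod τ).prod η) := by
    refine (integrable_prod_iff' (hm1.pow_const 2).aestronglyMeasurable).2 ⟨?_, ?_⟩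
    · exact Eventually.of_forall fun y =>
        integrable_of_measurable_abs_le ((hf.comp (measurable_fst.prodMk measurable_const)).pow_const 2)
          fun ab => abs_sq_le_one_of_abs_le_one (hb _)
    · have h := hρ.integral_norm_prod_right
      have heq : ∀ y, ∫ ab : X × X, ‖f (ab.1, y) ^ 2‖ ∂(ρ.prod τ) = τ.real univ * ∫ a, ‖f (a, y) ^ 2‖ ∂ρ :=
        fun y => by
          rw [← smul_eq_mul]
          exact integral_fun_fst (μ := ρ) (ν := τ) (fun a => ‖f (a, y) ^ 2‖)
      simp_rw [heq]
      exact h.const_mul _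
  have hg2 : Integrable (fun p : (X × X) × Y => f (p.1.2, p.2) ^ 2) ((ρ.prod τ).prod η) := by
    refine (integrable_prod_iff' (hm2.pow_const 2).aestronglyMeasurable).2 ⟨?_, ?_⟩
    · exact Eventually.of_forall fun y =>
        integrable_of_measurable_abs_le ((hf.comp (measurable_snd.prodMk measurable_const)).pow_const 2)
          fun ab => abs_sq_le_one_of_abs_le_one (hb _)
    · have h := hτ.integral_norm_prod_right
      have heq : ∀ y, ∫ ab : X × X, ‖f (ab.2, y) ^ 2‖ ∂(ρ.prod τ) = ρ.real univ * ∫ b, ‖f (b, y) ^ 2‖ ∂τ :=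
        fun y => by
          rw [← smul_eq_mul]
          exact integral_fun_snd (μ := ρ) (ν := τ) (fun b => ‖f (b, y) ^ 2‖)
      simp_rw [heq]
      exact h.const_mul _
  -- the cross term and the kernel integrand
  have hg3 : Integrable (fun p : (X × X) × Y => f (p.1.1, p.2) * f (p.1.2, p.2)) ((ρ.prod τ).prod η) := by
    refine (hg1.add hg2).mono' (hm1.mul hm2).aestronglyMeasurable (Eventually.of_forall fun p => ?_)
    rw [Real.norm_eq_abs, abs_mul, Pi.add_apply]
    nlinarith [abs_nonneg (f (p.1.1, p.2)), abs_nonneg (f (p.1.2, p.2)), sq_abs (f (p.1.1, p.2)),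
      sq_abs (f (p.1.2, p.2))]
  have hG : Integrable (fun p : (X × X) × Y => (f (p.1.1, p.2) - f (p.1.2, p.2)) ^ 2) ((ρ.prod τ).prod η) := by
    refine ((hg1.add hg2).const_mul 2).mono' ((hm1.sub hm2).pow_const 2).aestronglyMeasurable
      (Eventually.of_forall fun p => ?_)
    rw [Real.norm_eq_abs, abs_of_nonneg (sq_nonneg _), Pi.add_apply]
    nlinarith [sq_nonneg (f (p.1.1, p.2) + f (p.1.2, p.2))]
  -- the product `F_ρ F_τ` is the `(ρ ⊗ τ)`-integral of the cross term
  have hprod : ∀ y, (∫ a, f (a, y) ∂ρ) * (∫ b, f (b, y) ∂τ) =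
      ∫ ab : X × X, f (ab.1, y) * f (ab.2, y) ∂(ρ.prod τ) := fun y =>
    (integral_prod_mul (μ := ρ) (ν := τ) (fun a => f (a, y)) (fun b => f (b, y))).symm
  have hI : Integrable (fun y => (∫ a, f (a, y) ∂ρ) * (∫ b, f (b, y) ∂τ)) η := by
    simp_rw [hprod]
    exact hg3.integral_prod_right
  refine ⟨hI, ?_⟩
  -- Fubini: `∫∫ K dτ dρ = ∫ (ρ⊗τ) K = ∫_η ∫_(ρ⊗τ) (f(a,y) - f(b,y))²`
  have hKi : Integrable (fun ab : X × X => ∫ y, (f (ab.1, y) - f (ab.2, y)) ^ 2 ∂η) (ρ.prod τ) :=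
    hG.integral_prod_left
  have h1 : ∫ a, ∫ b, (∫ y, (f (a, y) - f (b, y)) ^ 2 ∂η) ∂τ ∂ρ =
      ∫ ab : X × X, (∫ y, (f (ab.1, y) - f (ab.2, y)) ^ 2 ∂η) ∂(ρ.prod τ) :=
    (integral_prod _ hKi).symm
  have h2 : ∫ ab : X × X, (∫ y, (f (ab.1, y) - f (ab.2, y)) ^ 2 ∂η) ∂(ρ.prod τ) =
      ∫ y, ∫ ab : X × X, (f (ab.1, y) - f (ab.2, y)) ^ 2 ∂(ρ.prod τ) ∂η :=
    integral_integral_swap (f := fun (ab : X × X) (y : Y) => (f (ab.1, y) - f (ab.2, y)) ^ 2) (by exact hG)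
  -- the inner integral, for every `y`
  have h3 : ∀ y, ∫ ab : X × X, (f (ab.1, y) - f (ab.2, y)) ^ 2 ∂(ρ.prod τ) =
      τ.real univ * ∫ a, f (a, y) ^ 2 ∂ρ + ρ.real univ * ∫ b, f (b, y) ^ 2 ∂τ
        - 2 * ((∫ a, f (a, y) ∂ρ) * (∫ b, f (b, y) ∂τ)) := by
    intro y
    have i1 : Integrable (fun ab : X × X => f (ab.1, y) ^ 2) (ρ.prod τ) :=
      integrable_of_measurable_abs_le ((hf.comp (measurable_fst.prodMk measurable_const)).pow_const 2)
        fun ab => abs_sq_le_one_of_abs_le_one (hb _)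
    have i2 : Integrable (fun ab : X × X => f (ab.2, y) ^ 2) (ρ.prod τ) :=
      integrable_of_measurable_abs_le ((hf.comp (measurable_snd.prodMk measurable_const)).pow_const 2)
        fun ab => abs_sq_le_one_of_abs_le_one (hb _)
    have i3 : Integrable (fun ab : X × X => f (ab.1, y) * f (ab.2, y)) (ρ.prod τ) :=
      integrable_of_measurable_abs_le ((hf.comp (measurable_fst.prodMk measurable_const)).mul
        (hf.comp (measurable_snd.prodMk measurable_const))) fun ab => abs_mul_le_one_of_abs_le_one (hb _) (hb _)
    have e : (fun ab : X × X => (f (ab.1, y) - f (ab.2, y)) ^ 2) =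
        fun ab => (f (ab.1, y) ^ 2 + f (ab.2, y) ^ 2) - 2 * (f (ab.1, y) * f (ab.2, y)) := by
      funext ab; ring
    have j1 : ∫ ab : X × X, f (ab.1, y) ^ 2 ∂(ρ.prod τ) = τ.real univ * ∫ a, f (a, y) ^ 2 ∂ρ := by
      rw [← smul_eq_mul]; exact integral_fun_fst (μ := ρ) (ν := τ) (fun a => f (a, y) ^ 2)
    have j2 : ∫ ab : X × X, f (ab.2, y) ^ 2 ∂(ρ.prod τ) = ρ.real univ * ∫ b, f (b, y) ^ 2 ∂τ := by
      rw [← smul_eq_mul]; exact integral_fun_snd (μ := ρ) (ν := τ) (fun b => f (b, y) ^ 2)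
    have i12 : Integrable (fun ab : X × X => f (ab.1, y) ^ 2 + f (ab.2, y) ^ 2) (ρ.prod τ) := i1.add i2
    rw [e, integral_sub i12 (i3.const_mul 2), integral_add i1 i2, integral_const_mul, hprod y, j1, j2]
  rw [h1, h2]
  simp_rw [h3]
  have j1 : Integrable (fun y => ∫ a, f (a, y) ^ 2 ∂ρ) η := hρ.integral_prod_right
  have j2 : Integrable (fun y => ∫ b, f (b, y) ^ 2 ∂τ) η := hτ.integral_prod_right
  have k1 : Integrable (fun y => τ.real univ * ∫ a, f (a, y) ^ 2 ∂ρ + ρ.real univ * ∫ b, f (b, y) ^ 2 ∂τ) η :=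
    (j1.const_mul _).add (j2.const_mul _)
  rw [integral_sub k1 (hI.const_mul 2), integral_add (j1.const_mul _) (j2.const_mul _), integral_const_mul,
    integral_const_mul, integral_const_mul, integral_prod_symm _ hρ, integral_prod_symm _ hτ]

/-- **The energy identity.** In the setting of `integral_integral_kernel_eq`, for two finite measures `μ`, `ν`
of equal mass, `2∫∫K dν dμ - ∫∫K dμ dμ - ∫∫K dν dν = 2 ∫ (F_μ - F_ν)² dη`, and `(F_μ - F_ν)²` is
`η`-integrable. [folklore] -/
theorem energy_identity {f : X × Y → ℝ} (hf : Measurable f) (hb : ∀ p, |f p| ≤ 1)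
    (μ ν : Measure X) [IsFiniteMeasure μ] [IsFiniteMeasure ν] (η : Measure Y) [SigmaFinite η]
    (hμ : Integrable (fun p => f p ^ 2) (μ.prod η)) (hν : Integrable (fun p => f p ^ 2) (ν.prod η))
    (hm : μ univ = ν univ) :
    Integrable (fun y => (∫ a, f (a, y) ∂μ - ∫ a, f (a, y) ∂ν) ^ 2) η ∧
    2 * ∫ a, ∫ b, (∫ y, (f (a, y) - f (b, y)) ^ 2 ∂η) ∂ν ∂μ
      - ∫ a, ∫ b, (∫ y, (f (a, y) - f (b, y)) ^ 2 ∂η) ∂μ ∂μ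
      - ∫ a, ∫ b, (∫ y, (f (a, y) - f (b, y)) ^ 2 ∂η) ∂ν ∂ν
      = 2 * ∫ y, (∫ a, f (a, y) ∂μ - ∫ a, f (a, y) ∂ν) ^ 2 ∂η := by
  obtain ⟨iμν, eμν⟩ := integral_integral_kernel_eq hf hb μ ν η hμ hν
  obtain ⟨iμμ, eμμ⟩ := integral_integral_kernel_eq hf hb μ μ η hμ hμ
  obtain ⟨iνν, eνν⟩ := integral_integral_kernel_eq hf hb ν ν η hν hν
  have hmr : μ.real univ = ν.real univ := by simp only [measureReal_def, hm]
  have e : (fun y => (∫ a, f (a, y) ∂μ - ∫ a, f (a, y) ∂ν) ^ 2) = fun y =>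
      ((∫ a, f (a, y) ∂μ) * (∫ a, f (a, y) ∂μ) + (∫ a, f (a, y) ∂ν) * (∫ a, f (a, y) ∂ν))
        - 2 * ((∫ a, f (a, y) ∂μ) * (∫ a, f (a, y) ∂ν)) := by
    funext y; ring
  have k1 : Integrable (fun y => (∫ a, f (a, y) ∂μ) * (∫ a, f (a, y) ∂μ) +
      (∫ a, f (a, y) ∂ν) * (∫ a, f (a, y) ∂ν)) η := iμμ.add iνν
  have hI : Integrable (fun y => (∫ a, f (a, y) ∂μ - ∫ a, f (a, y) ∂ν) ^ 2) η := by
    rw [e]; exact k1.sub (iμν.const_mul 2)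
  refine ⟨hI, ?_⟩
  rw [eμν, eμμ, eνν, e, integral_sub k1 (iμν.const_mul 2), integral_add iμμ iνν, integral_const_mul, hmr]
  ring

/-- **Equality case of the energy identity.** If moreover the energy
`2∫∫K dν dμ - ∫∫K dμ dμ - ∫∫K dν dν` is `≤ 0`, then `F_μ = F_ν` `η`-almost everywhere. [folklore] -/
theorem ae_eq_of_energy_le_zero {f : X × Y → ℝ} (hf : Measurable f) (hb : ∀ p, |f p| ≤ 1)
    (μ ν : Measure X) [IsFiniteMeasure μ] [IsFiniteMeasure ν] (η : Measure Y) [SigmaFinite η]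
    (hμ : Integrable (fun p => f p ^ 2) (μ.prod η)) (hν : Integrable (fun p => f p ^ 2) (ν.prod η))
    (hm : μ univ = ν univ)
    (hE : 2 * ∫ a, ∫ b, (∫ y, (f (a, y) - f (b, y)) ^ 2 ∂η) ∂ν ∂μ
      - ∫ a, ∫ b, (∫ y, (f (a, y) - f (b, y)) ^ 2 ∂η) ∂μ ∂μ
      - ∫ a, ∫ b, (∫ y, (f (a, y) - f (b, y)) ^ 2 ∂η) ∂ν ∂ν ≤ 0) :
    (fun y => ∫ a, f (a, y) ∂μ) =ᵐ[η] fun y => ∫ a, f (a, y) ∂ν := by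
  obtain ⟨hI, hId⟩ := energy_identity hf hb μ ν η hμ hν hm
  have h0 : ∫ y, (∫ a, f (a, y) ∂μ - ∫ a, f (a, y) ∂ν) ^ 2 ∂η = 0 :=
    le_antisymm (by linarith) (integral_nonneg fun y => sq_nonneg _)
  have h1 := (integral_eq_zero_iff_of_nonneg (fun y => sq_nonneg _) hI).1 h0
  filter_upwards [h1] with y hy
  have : (∫ a, f (a, y) ∂μ - ∫ a, f (a, y) ∂ν) ^ 2 = 0 := hy
  exact sub_eq_zero.1 (pow_eq_zero_iff two_ne_zero |>.1 this)

/-! ## Distribution functions agreeing almost everywhere -/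

/-- **Right-continuity upgrade.** Two finite measures on `ℝ` whose distribution functions `t ↦ ρ (-∞, t]`
agree Lebesgue-almost everywhere are equal (both distribution functions are right-continuous, and a Lebesgue-full
set meets every right neighbourhood; then `Measure.ext_of_Iic`). [folklore] -/
theorem measure_eq_of_ae_measure_Iic_eq (α β : Measure ℝ) [IsFiniteMeasure α] [IsFiniteMeasure β]
    (h : ∀ᵐ t ∂(volume : Measure ℝ), α (Iic t) = β (Iic t)) : α = β := by
  refine Measure.ext_of_Iic α β fun t => ?_
  -- right-continuity of distribution functions
  have hrc : ∀ (ρ : Measure ℝ) [IsFiniteMeasure ρ],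
      Tendsto (fun s => ρ (Iic s)) (𝓝[Ioi t] t) (𝓝 (ρ (Iic t))) := by
    intro ρ _
    have hI : (⋂ r > t, Iic r) = Iic t := by
      ext x
      simp only [mem_iInter, mem_Iic]
      exact ⟨fun hx => le_of_forall_gt_imp_ge_of_dense hx, fun hx r hr => hx.trans hr.le⟩
    have h := tendsto_measure_biInter_gt (μ := ρ) (s := fun r => Iic r) (a := t)
      (fun r _ => measurableSet_Iic.nullMeasurableSet) (fun i j _ hij => Iic_subset_Iic.2 hij)
      ⟨t + 1, by simp, measure_ne_top _ _⟩
    rwa [hI] at h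
  -- the good set meets every right neighbourhood of `t`
  set G : Set ℝ := {s | α (Iic s) = β (Iic s)} with hG
  have hGc : volume Gᶜ = 0 := by
    have := ae_iff.1 h
    simpa only [hG, compl_setOf] using this
  have hne : (𝓝[Ioi t ∩ G] t).NeBot := by
    rw [← mem_closure_iff_nhdsWithin_neBot, Metric.mem_closure_iff]
    intro ε hε
    by_contra! hcon
    have hsub : Ioo t (t + ε) ⊆ Gᶜ := fun s hs hsG => by
      have h1 := hcon s ⟨hs.1, hsG⟩
      rw [Real.dist_eq, abs_of_nonpos (by linarith [hs.1])] at h1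
      linarith [hs.2]
    have h0 : volume (Ioo t (t + ε)) = 0 := measure_mono_null hsub hGc
    rw [Real.volume_Ioo, ENNReal.ofReal_eq_zero] at h0
    linarith
  have h1 : Tendsto (fun s => α (Iic s)) (𝓝[Ioi t ∩ G] t) (𝓝 (α (Iic t))) :=
    (hrc α).mono_left (nhdsWithin_mono _ inter_subset_left)
  have h2 : Tendsto (fun s => β (Iic s)) (𝓝[Ioi t ∩ G] t) (𝓝 (β (Iic t))) :=
    (hrc β).mono_left (nhdsWithin_mono _ inter_subset_left)
  have h12 : (fun s => α (Iic s)) =ᶠ[𝓝[Ioi t ∩ G] t] fun s => β (Iic s) :=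
    eventually_mem_nhdsWithin.mono fun s hs => hs.2
  exact tendsto_nhds_unique_of_eventuallyEq h1 h2 h12

/-! ## Uniform integrability of second moments along a tail schedule -/

/-- The tail `∫_{L < ‖v‖} ‖v‖²` of a single measure with a second moment is eventually (in `L`) below any
`ε > 0`. [folklore] -/
theorem eventually_tail_sq_le {ρ : Measure V3} (h2 : Integrable (fun v : V3 => ‖v‖ ^ 2) ρ) {ε : ℝ}
    (hε : 0 < ε) : ∀ᶠ L : ℝ in atTop, ∫ v in {v : V3 | L < ‖v‖}, ‖v‖ ^ 2 ∂ρ ≤ ε := by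
  have hsm : ∀ L : ℝ, MeasurableSet {v : V3 | L < ‖v‖} := fun L =>
    measurableSet_lt measurable_const measurable_norm
  have hlim : Tendsto (fun n : ℕ => ∫ v in {v : V3 | (n : ℝ) < ‖v‖}, ‖v‖ ^ 2 ∂ρ) atTop
      (𝓝 (∫ v in ⋂ n : ℕ, {v : V3 | (n : ℝ) < ‖v‖}, ‖v‖ ^ 2 ∂ρ)) :=
    Antitone.tendsto_setIntegral (fun n => hsm n)
      (fun m n hmn v (hv : (n : ℝ) < ‖v‖) => lt_of_le_of_lt (Nat.cast_le.2 hmn) hv) h2.integrableOn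
  have hempty : (⋂ n : ℕ, {v : V3 | (n : ℝ) < ‖v‖}) = ∅ := by
    ext v
    simp only [mem_iInter, mem_setOf_eq, mem_empty_iff_false, iff_false, not_forall, not_lt]
    exact ⟨⌈‖v‖⌉₊, Nat.le_ceil _⟩
  rw [hempty, Measure.restrict_empty, integral_zero_measure] at hlim
  obtain ⟨N, hN⟩ := (tendsto_order.1 hlim).2 ε hε |>.exists_forall_of_atTop
  filter_upwards [eventually_ge_atTop (N : ℝ)] with L hL
  refine le_trans ?_ (hN N le_rfl).le
  exact setIntegral_mono_set h2.integrableOn (Eventually.of_forall fun v => sq_nonneg _)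
    (Eventually.of_forall fun v (hv : L < ‖v‖) => lt_of_le_of_lt hL hv)

/-- **Uniform integrability from a tail schedule.** If the `n`-th measure obeys the tail bounds
`∫_{Lt j < ‖v‖} ‖v‖² ≤ 1/(j+1)` for all `j ≤ n`, and every measure has a second moment, then the second moments
are uniformly integrable along the whole sequence. [folklore] -/
theorem uniformIntegrable_of_schedule {ρs : ℕ → Measure V3} (h2 : ∀ n, Integrable (fun v : V3 => ‖v‖ ^ 2) (ρs n))
    {Lt : ℕ → ℝ} (hs : ∀ j n, j ≤ n → ∫ v in {v : V3 | Lt j < ‖v‖}, ‖v‖ ^ 2 ∂(ρs n) ≤ 1 / ((j : ℝ) + 1))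
    {ε : ℝ} (hε : 0 < ε) : ∃ L : ℝ, ∀ n, ∫ v in {v : V3 | L < ‖v‖}, ‖v‖ ^ 2 ∂(ρs n) ≤ ε := by
  obtain ⟨j, hj⟩ := exists_nat_one_div_lt hε
  have hsmall : ∀ᶠ L : ℝ in atTop, ∀ n ∈ Finset.range j, ∫ v in {v : V3 | L < ‖v‖}, ‖v‖ ^ 2 ∂(ρs n) ≤ ε :=
    (Finset.range j).eventually_all.2 fun n _ => eventually_tail_sq_le (h2 n) hε
  obtain ⟨L, hL1, hL2⟩ := (hsmall.and (eventually_ge_atTop (Lt j))).exists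
  refine ⟨L, fun n => ?_⟩
  by_cases hn : n < j
  · exact hL1 n (Finset.mem_range.2 hn)
  · refine le_trans ?_ ((hs j n (not_lt.1 hn)).trans hj.le)
    exact setIntegral_mono_set (h2 n).integrableOn (Eventually.of_forall fun v => sq_nonneg _)
      (Eventually.of_forall fun v (hv : L < ‖v‖) => lt_of_le_of_lt hL2 hv)

/-! ## Weak convergence of rescaled probability measures -/

/-- If probability measures `Pₙ → P` weakly and masses `mₙ → m`, then `mₙ • Pₙ → m • P` weakly as finite
measures. [folklore] -/
theorem tendsto_smul_toFiniteMeasure {Ω : Type*} [MeasurableSpace Ω] [TopologicalSpace Ω]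
    [OpensMeasurableSpace Ω] {Ps : ℕ → ProbabilityMeasure Ω} {P : ProbabilityMeasure Ω}
    (hP : Tendsto Ps atTop (𝓝 P)) {ms : ℕ → NNReal} {m : NNReal} (hm : Tendsto ms atTop (𝓝 m)) :
    Tendsto (fun n => ms n • (Ps n).toFiniteMeasure) atTop (𝓝 (m • P.toFiniteMeasure)) := by
  rw [ProbabilityMeasure.tendsto_nhds_iff_toFiniteMeasure_tendsto_nhds,
    FiniteMeasure.tendsto_iff_forall_testAgainstNN_tendsto] at hP
  rw [FiniteMeasure.tendsto_iff_forall_testAgainstNN_tendsto]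
  intro f
  simp only [FiniteMeasure.smul_testAgainstNN_apply, smul_eq_mul]
  exact hm.mul (hP f)

/-! ## Registered sub-goal -/

/-- **Registered sub-goal `stub_energyDistanceA` (helper A of `stub_energyDistance`): the abstract energy identity** —
for a bounded jointly measurable `f`, square integrable under `μ ⊗ η` and `ν ⊗ η` with `|μ| = |ν|`, the kernel
`K(a,b) = ∫ (f(a,y) - f(b,y))² dη` has `2∫∫K dν dμ - ∫∫K dμ dμ - ∫∫K dν dν = 2∫(F_μ - F_ν)² dη`. [folklore] -/
theorem stub_energyDistanceA : ∀ {X Y : Type} [MeasurableSpace X] [MeasurableSpace Y] {f : X × Y → ℝ}, Measurable f → (∀ p, |f p| ≤ 1) → ∀ (μ ν : Measure X) [IsFiniteMeasure μ] [IsFiniteMeasure ν] (η : Measure Y) [SigmaFinite η], Integrable (fun p => f p ^ 2) (μ.prod η) → Integrable (fun p => f p ^ 2) (ν.prod η) → μ Set.univ = ν Set.univ → 2 * ∫ a, ∫ b, (∫ y, (f (a, y) - f (b, y)) ^ 2 ∂η) ∂ν ∂μ - ∫ a, ∫ b, (∫ y, (f (a, y) - f (b, y)) ^ 2 ∂η)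 ∂μ ∂μ - ∫ a, ∫ b, (∫ y, (f (a, y) - f (b, y)) ^ 2 ∂η) ∂ν ∂ν = 2 * ∫ y, (∫ a, f (a, y) ∂μ - ∫ a, f (a, y) ∂ν) ^ 2 ∂η :=
  fun hf hb μ ν _ _ η _ hμ hν hm => (energy_identity hf hb μ ν η hμ hν hm).2

end Summit.AtomisticToContinuum.HydrodynamicLimit.Theorems.ChaosClosesEulerEnergyDistance

end
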